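import Summits.ABC.ABC.Theorems.SoloBlindCycloRadFloor
import HarnessLib

/-!
# Polynomial abc in cyclotomic–radical coordinates (solo-ABC-blind, file 3)

`PolyABC K` (file 1) is `∃ C > 0, c ≤ C · rad(abc)^K` for all abc triples.  This file pins the
three levels of the scale on the kernel side:

* `abc_iff_polyABC`          : `ABC ↔ ∀ K > 1, PolyABC K`;
* `polyABC_pos`              : `PolyABC K → 0 < K` (the triples `(1, N, N + 1)` are unbounded);
* `polyABC_mono`             : `PolyABC K → K ≤ K' → PolyABC K'`;
* `radLowerBound_of_polyABC` : `PolyABC K → rad(u·v·(vⁿ − uⁿ)) ≥ κ · v^(n/K)` for every `n ≥ 1`;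
* `polyABC_iff_radLowerBound`: `(∃ K, PolyABC K) ↔ ∃ k, ∃ θ > 0, ∃ κ > 0,`
  `rad(u·v·(v^(k+1) − u^(k+1))) ≥ κ · v^(k+θ)` for all coprime `0 < u < v` —
  "polynomial abc" is *exactly* "one exponent beyond `n − 1` in one cyclotomic family".

No exponent `> n − 1` (indeed no exponent `> 0`) is known for any `n`: the known floor is
`n log v ≤ C ρ^{1/3} (log ρ)^3` (`cycloRadFloor_of_stewartYu`, file 2).
-/

open UniqueFactorizationMonoid

namespace Summit.ABC.ABC.Theorems

open Literature.NumberTheory.DiophantineGeometry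

/-- `(1, N, N+1)` is an abc triple for `N ≥ 1`. [folklore] -/
theorem isABCTriple_one (N : ℕ) (hN : 0 < N) : IsABCTriple 1 N (N + 1) :=
  ⟨Nat.one_pos, hN, by omega, Nat.coprime_one_left N⟩

/-- `ABC ↔ ∀ K > 1, PolyABC K`. [folklore] -/
theorem abc_iff_polyABC : ABC ↔ ∀ K : ℝ, 1 < K → PolyABC K := by
  refine ⟨fun h K hK => polyABC_of_abc h hK, fun h => ?_⟩
  rw [ABC_iff]
  intro ε hε
  obtain ⟨C, hC, HC⟩ := h (1 + ε) (by linarith)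
  refine ⟨C + 1, by positivity, fun a b c habc => ?_⟩
  have hR := rad_cast_pos habc
  have hpow : (0 : ℝ) < ((rad a b c : ℕ) : ℝ) ^ (1 + ε) := Real.rpow_pos_of_pos hR _
  calc (c : ℝ) ≤ C * ((rad a b c : ℕ) : ℝ) ^ (1 + ε) := HC a b c habc
    _ < (C + 1) * ((rad a b c : ℕ) : ℝ) ^ (1 + ε) := by nlinarith

/-- A polynomial abc exponent is positive: `PolyABC K → 0 < K`. [folklore] -/
theorem polyABC_pos {K : ℝ} (h : PolyABC K) : 0 < K := by
  obtain ⟨C, hC, HC⟩ := h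
  by_contra hK
  push Not at hK
  -- the triple (1, N, N+1) with N = ⌈C⌉₊ + 1 has c = N + 1 > C but rad^K ≤ 1
  set N : ℕ := ⌈C⌉₊ + 1 with hNdef
  have hN : 0 < N := by omega
  have habc := isABCTriple_one N hN
  have h1 := HC 1 N (N + 1) habc
  have hR := rad_cast_pos habc
  have hR1 : (1 : ℝ) ≤ ((rad 1 N (N + 1) : ℕ) : ℝ) := by
    exact_mod_cast Nat.one_le_iff_ne_zero.mpr (by
      intro h0; rw [h0] at hR; simp at hR)
  have hle1 : ((rad 1 N (N + 1) : ℕ) : ℝ) ^ K ≤ 1 :=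
    Real.rpow_le_one_of_one_le_of_nonpos hR1 hK
  have hcC : ((N + 1 : ℕ) : ℝ) ≤ C := by
    calc ((N + 1 : ℕ) : ℝ) ≤ C * ((rad 1 N (N + 1) : ℕ) : ℝ) ^ K := h1
      _ ≤ C * 1 := by exact mul_le_mul_of_nonneg_left hle1 hC.le
      _ = C := mul_one C
  have hceil : C ≤ (⌈C⌉₊ : ℝ) := Nat.le_ceil C
  have : ((N + 1 : ℕ) : ℝ) = (⌈C⌉₊ : ℝ) + 2 := by rw [hNdef]; push_cast; ring
  linarith

/-- Monotonicity in the exponent: `PolyABC K → K ≤ K' → PolyABC K'` (as `rad ≥ 1`). [folklore] -/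
theorem polyABC_mono {K K' : ℝ} (h : PolyABC K) (hKK' : K ≤ K') : PolyABC K' := by
  obtain ⟨C, hC, HC⟩ := h
  refine ⟨C, hC, fun a b c habc => ?_⟩
  have hR := rad_cast_pos habc
  have hR1 : (1 : ℝ) ≤ ((rad a b c : ℕ) : ℝ) := by
    exact_mod_cast Nat.one_le_iff_ne_zero.mpr (by
      intro h0; rw [h0] at hR; simp at hR)
  calc (c : ℝ) ≤ C * ((rad a b c : ℕ) : ℝ) ^ K := HC a b c habc
    _ ≤ C * ((rad a b c : ℕ) : ℝ) ^ K' :=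
      mul_le_mul_of_nonneg_left (Real.rpow_le_rpow_of_exponent_le hR1 hKK') hC.le

/-- **`PolyABC K` read in cyclotomic–radical coordinates**: for every `n ≥ 1` there is `κ > 0`
with `κ · v^(n/K) ≤ rad(u·v·(vⁿ − uⁿ))` for all coprime `0 < u < v`
(apply the inequality to the power triple `(uⁿ, vⁿ − uⁿ, vⁿ)`). [folklore] -/
theorem radLowerBound_of_polyABC {K : ℝ} (h : PolyABC K) {n : ℕ} (hn : 1 ≤ n) :
    ∃ κ : ℝ, 0 < κ ∧ ∀ u v : ℕ, 0 < u → u < v → Nat.Coprime u v →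
      κ * (v : ℝ) ^ ((n : ℝ) / K) ≤ ((radical (u * v * (v ^ n - u ^ n)) : ℕ) : ℝ) := by
  have hK := polyABC_pos h
  obtain ⟨C, hC, HC⟩ := h
  refine ⟨(1 / C) ^ (1 / K), by positivity, fun u v hu huv hcop => ?_⟩
  have habc := isABCTriple_pow_sub_pow hn hu huv hcop
  have h1 := HC _ _ _ habc
  rw [rad_pow_sub_pow hn hu huv] at h1
  push_cast at h1
  set ρ : ℝ := ((radical (u * v * (v ^ n - u ^ n)) : ℕ) : ℝ) with hρdef
  have hρ0 : (0 : ℝ) ≤ ρ := by positivity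
  have hv0 : (0 : ℝ) ≤ (v : ℝ) := by positivity
  -- (v^n / C) ≤ ρ^K
  have h2 : (v : ℝ) ^ n * (1 / C) ≤ ρ ^ K := by
    rw [mul_one_div, div_le_iff₀ hC]; linarith [h1]
  have h3 : ((v : ℝ) ^ n * (1 / C)) ^ (1 / K) ≤ (ρ ^ K) ^ (1 / K) :=
    Real.rpow_le_rpow (by positivity) h2 (by positivity)
  have h4 : (ρ ^ K) ^ (1 / K) = ρ := by
    rw [← Real.rpow_mul hρ0, mul_one_div_cancel hK.ne', Real.rpow_one]
  have h5 : ((v : ℝ) ^ n * (1 / C)) ^ (1 / K) = (1 / C) ^ (1 / K) * (v : ℝ) ^ ((n : ℝ) / K) := by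
    rw [Real.mul_rpow (by positivity) (by positivity), ← Real.rpow_natCast,
      ← Real.rpow_mul hv0, mul_one_div]
    ring
  rw [h4, h5] at h3
  exact h3

/-- **Polynomial abc = one exponent beyond `n − 1` in one cyclotomic family.**
`(∃ K, PolyABC K) ↔ ∃ k θ κ, 0 < θ ∧ 0 < κ ∧ ∀ coprime 0 < u < v, κ v^(k+θ) ≤ rad(u v (v^(k+1) − u^(k+1)))`.
(`→`: take `k = 0`, `θ = 1/K`; `←`: `polyABC_of_radLowerBound` gives `PolyABC (1/θ)`.) [folklore] -/
theorem polyABC_iff_radLowerBound :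
    (∃ K : ℝ, PolyABC K) ↔
      ∃ k : ℕ, ∃ θ κ : ℝ, 0 < θ ∧ 0 < κ ∧ ∀ u v : ℕ, 0 < u → u < v → Nat.Coprime u v →
        κ * (v : ℝ) ^ ((k : ℝ) + θ) ≤ ((radical (u * v * (v ^ (k + 1) - u ^ (k + 1))) : ℕ) : ℝ) := by
  constructor
  · rintro ⟨K, hP⟩
    have hK := polyABC_pos hP
    obtain ⟨κ, hκ, H⟩ := radLowerBound_of_polyABC hP (le_refl 1)
    refine ⟨0, 1 / K, κ, by positivity, hκ, fun u v hu huv hcop => ?_⟩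
    have := H u v hu huv hcop
    simpa [zero_add, Nat.cast_zero, pow_one] using this
  · rintro ⟨k, θ, κ, hθ, hκ, H⟩
    exact ⟨1 / θ, polyABC_of_radLowerBound k hθ hκ H⟩

end Summit.ABC.ABC.Theorems
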